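import Summits.AtomisticToContinuum.Crystallization.Theses.HcpDefectCounting

/-!
# Line `birth` — birth-certificate skeleton (BC3) for the crux `HcpChartGluing`
(stmt-AtomisticToContinuum-14478, route `HcpDefectCounting`, rank 4, sub-problem `Crystallization`)

THE CRUX (chart gluing for hcp, counting form; potential-free): for `(a,h)` in the box
`47/50 ≤ a ≤ 1`, `39/50·a ≤ h ≤ 17/20·a` and all `δ, R, ε > 0` there are `θ > 0` and `M ∈ ℕ` with
`#{i : ¬Good(R,ε,i)} ≤ M · #{i : ¬Good(4,θ,i)}` for every finite `δ`-separated configuration, where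
`Good(ρ,η,i)` = some linear isometry `A` two-way `η`-matches the particles within `ρ` of `x i` with
`x i + A(hcp sites of norm ≤ ρ)`.

THE LINE (the route's own two-layer plan "HcpShellRigidity → ChartExtension → HcpChartGluing" in the
shape both refuters recommended: EXACT local rigidity + COMPACTNESS upgrade + PACKING count):

* `stub_exactLocalRigidity` (M–L; the `θ = 0` chart extension, for point SETS of any cardinality):
  for `(a,h)` in the box and `R > 0` there is `D` such that: if `y₀ ∈ Y ⊆ ℝ³` and every point of `Y`
  within `D` of `y₀` carries an EXACT origin-based chart of radius `39/10` (an isometric copy of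
  `hcpStacking a h ∩ B̄(0,39/10)` recentred at the point coincides with `Y ∩ B̄(point, 39/10)`), then
  `y₀` carries an exact chart of radius `R`.  Induction `ρ ↦ ρ + 1` from `ρ = 39/10`: a site `q` of the
  global chart with `dist q y₀ ≤ ρ − 1.03a` has its 12-point first shell (6 at `a`, 6 at `√(a²/3+h²)
  ≤ 1.0275a`; next shell `≥ 1.39a` on the box) inside `B̄(y₀,ρ)`, so its local chart agrees with the
  global one up to an element of `Sym(first shell) = D3h = Stab₀(hcp)` composed with the
  vertex-transitivity isometry (`hcp − p ∈ {hcp, −hcp}`); covering radius `≤ 0.72a` puts every point at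
  distance `≤ ρ + 1` within `1 + 1.03 + 1.44 < 39/10` of such a `q`.  `D = R` suffices.
* `stub_compactnessUpgrade` (L, THE HARDEST; exact ⇒ robust at fixed `(a,h)`): the exact statement
  implies the robust LOCAL PROPAGATION: for `δ, R, ε > 0` there are `θ > 0`, `D` such that in every
  finite `δ`-separated configuration a particle all of whose neighbours within `D` are `Good(4,θ)` is
  `Good(R,ε)`.  Contradiction + compactness: `θₙ → 0`, translate the centre to `0`, `δ`-separation
  bounds the number of particles in `B̄(0,D+R+6)` (packing), extract convergent positions and charts
  (`O(3)` compact); in the limit every point within `D_exact` has an EXACT chart on the CLOSED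
  `39/10`-ball (`39/10 < 4` absorbs particles converging from outside radius `4`); the exact stub gives
  an exact `R`-chart at `0`, and finite-window matching is open, so the centres are `Good(R,ε)`
  eventually — contradiction.
* `stub_neighbourhoodCount` (M; packing + double counting, potential- and template-free): for
  `δ > 0` and `D` there is `M ∈ ℕ` with `#{i : some B-particle within D of x i} ≤ M · #B` for every
  finite `δ`-separated configuration in `ℝ³` and every set `B` of particles
  (`M = ⌊(2D/δ+1)³⌋`; tree: `card_le_of_separated_of_dist_le`).
* `card_le_mul_card_of_cover` (PROVED glue, pure counting) and `HcpChartGluing_of : HcpChartGluing`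
  — the crux concluded BY NAME: `(θ, D)` from `stub_compactnessUpgrade ∘ stub_exactLocalRigidity`,
  `M` from `stub_neighbourhoodCount`; a `Bad(R,ε)` particle has a `Bad(4,θ)` particle within `D`
  (contrapositive of local propagation), so `#Bad(R,ε) ≤ M · #Bad(4,θ)`.

Disproof used: none on file (`ledger crux ls stmt-AtomisticToContinuum-14478`: no workfiles,
2026-08-17).  Negatives honoured: the refuted unseparated stmt-3506 (piling witness) — every stub about
configurations keeps the `δ`-separation hypothesis; `θ, D, M` depend on `(a,h,δ,R,ε)` only.

Conventions: stub signatures are ONE LINE, FULLY QUALIFIED, no `let`, no local notation (they must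
survive textual restatement in a `Theorems/`-side `--supports` file); the template is the explicit
point set `hcpStacking a h` (`= (hcpPeriodicConfiguration ha hh).points`,
`hcpPeriodicConfiguration_points`), so no proof arguments `ha hh` occur in the stubs.
-/

noncomputable section

namespace Summit.AtomisticToContinuum.Crystallization.Cruxes.HcpChartGluing.Birth

open Literature.MathematicalPhysics.StatisticalMechanics
open Summit.AtomisticToContinuum.Crystallization.Theses.HcpDefectCounting

/-! ## Registered stubs (`sorry` only here) -/

/-- **stub_exactLocalRigidity** (`θ = 0` chart extension for point sets).  For `(a,h)` in the box and
`R > 0` there is `D` such that for every `Y ⊆ ℝ³` and `y₀ ∈ Y`: if every `y ∈ Y` with `dist y y₀ ≤ D`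
has a linear isometry `A` with `y + A p ∈ Y` for all sites `p ∈ hcpStacking a h`, `‖p‖ ≤ 39/10`, and
every `z ∈ Y` with `dist z y ≤ 39/10` of the form `y + A p`, `p` a site, then `y₀` has such a chart at
radius `R`. -/
theorem stub_exactLocalRigidity : ∀ a h : ℝ, 47 / 50 ≤ a → a ≤ 1 → 39 / 50 * a ≤ h → h ≤ 17 / 20 * a → ∀ R : ℝ, 0 < R → ∃ D : ℝ, ∀ (Y : Set (EuclideanSpace ℝ (Fin 3))) (y₀ : EuclideanSpace ℝ (Fin 3)), y₀ ∈ Y → (∀ y ∈ Y, dist y y₀ ≤ D → ∃ A : EuclideanSpace ℝ (Fin 3) →ₗᵢ[ℝ] EuclideanSpace ℝ (Fin 3), (∀ p ∈ Literature.MathematicalPhysics.StatisticalMechanics.hcpStacking a h, ‖p‖ ≤ 39 / 10 → y + A p ∈ Y) ∧ (∀ z ∈ Y, dist z y ≤ 39 / 10 → ∃ p ∈ Literature.MathematicalPhysics.StatisticalMechanics.hcpStacking a h, z = y + A p)) → ∃ A : EuclideanSpace ℝ (Fin 3) →ₗᵢ[ℝ] EuclideanSpace ℝ (Fin 3), (∀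 p ∈ Literature.MathematicalPhysics.StatisticalMechanics.hcpStacking a h, ‖p‖ ≤ R → y₀ + A p ∈ Y) ∧ (∀ z ∈ Y, dist z y₀ ≤ R → ∃ p ∈ Literature.MathematicalPhysics.StatisticalMechanics.hcpStacking a h, z = y₀ + A p) := by
  sorry

/-- **stub_compactnessUpgrade** (exact ⇒ robust local propagation, at fixed `(a,h)` in the box).
If the exact chart extension of `stub_exactLocalRigidity` holds at `(a,h)`, then for all
`δ, R, ε > 0` there are `θ > 0` and `D` such that, in every finite `δ`-separated configuration
`x : Fin N → ℝ³`, a particle `i` all of whose neighbours `j` with `dist (x j) (x i) ≤ D` are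
`Good(4,θ)` is itself `Good(R,ε)` (two-way matching with `x i + A (hcpStacking a h)`, as in the crux). -/
theorem stub_compactnessUpgrade : ∀ a h : ℝ, 47 / 50 ≤ a → a ≤ 1 → 39 / 50 * a ≤ h → h ≤ 17 / 20 * a → (∀ R : ℝ, 0 < R → ∃ D : ℝ, ∀ (Y : Set (EuclideanSpace ℝ (Fin 3))) (y₀ : EuclideanSpace ℝ (Fin 3)), y₀ ∈ Y → (∀ y ∈ Y, dist y y₀ ≤ D → ∃ A : EuclideanSpace ℝ (Fin 3) →ₗᵢ[ℝ] EuclideanSpace ℝ (Fin 3), (∀ p ∈ Literature.MathematicalPhysics.StatisticalMechanics.hcpStacking a h, ‖p‖ ≤ 39 / 10 → y + A p ∈ Y) ∧ (∀ z ∈ Y, dist z y ≤ 39 / 10 → ∃ p ∈ Literature.MathematicalPhysics.StatisticalMechanics.hcpStacking a h, z = y + A p)) → ∃ A : EuclideanSpace ℝ (Fin 3) →ₗᵢ[ℝ] EuclideanSpace ℝ (Fin 3), (∀ p ∈ Literature.MathematicalPhysics.StatisticalMechanics.hcpStacking a h, ‖p‖ ≤ R → y₀ + A p ∈ Y) ∧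 (∀ z ∈ Y, dist z y₀ ≤ R → ∃ p ∈ Literature.MathematicalPhysics.StatisticalMechanics.hcpStacking a h, z = y₀ + A p)) → ∀ δ R ε : ℝ, 0 < δ → 0 < R → 0 < ε → ∃ θ : ℝ, 0 < θ ∧ ∃ D : ℝ, ∀ (N : ℕ) (x : Fin N → EuclideanSpace ℝ (Fin 3)), (∀ i j : Fin N, i ≠ j → δ ≤ dist (x i) (x j)) → ∀ i : Fin N, (∀ j : Fin N, dist (x j) (x i) ≤ D → ∃ A : EuclideanSpace ℝ (Fin 3) →ₗᵢ[ℝ] EuclideanSpace ℝ (Fin 3), (∀ p ∈ Literature.MathematicalPhysics.StatisticalMechanics.hcpStacking a h, ‖p‖ ≤ 4 → ∃ k : Fin N, dist (x k) (x j + A p) ≤ θ) ∧ (∀ k : Fin N, dist (x k) (x j) ≤ 4 → ∃ p ∈ Literature.MathematicalPhysics.StatisticalMechanics.hcpStacking a h, dist (x k) (x j + A p) ≤ θ)) → ∃ A : EuclideanSpace ℝ (Fin 3) →ₗᵢ[ℝ] EuclideanSpace ℝ (Fin 3), (∀ p ∈ Literature.MathematicalPhysics.StatisticalMechanics.hcpStacking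 a h, ‖p‖ ≤ R → ∃ k : Fin N, dist (x k) (x i + A p) ≤ ε) ∧ (∀ k : Fin N, dist (x k) (x i) ≤ R → ∃ p ∈ Literature.MathematicalPhysics.StatisticalMechanics.hcpStacking a h, dist (x k) (x i + A p) ≤ ε) := by
  sorry

/-- **stub_neighbourhoodCount** (packing + double counting in `ℝ³`).  For `δ > 0` and any `D` there
is `M ∈ ℕ` such that for every finite `δ`-separated configuration `x : Fin N → ℝ³` and every set `B`
of particles, the particles having some `B`-particle within distance `D` number at most `M · #B`. -/
theorem stub_neighbourhoodCount : ∀ δ D : ℝ, 0 < δ → ∃ M : ℕ, ∀ (N : ℕ) (x : Fin N → EuclideanSpace ℝ (Fin 3)), (∀ i j : Fin N, i ≠ j → δ ≤ dist (x i) (x j)) → ∀ B : Fin N → Prop, Nat.card {i : Fin N // ∃ j : Fin N, B j ∧ dist (x j) (x i) ≤ D} ≤ M * Nat.card {j : Fin N // B j} := by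
  sorry

/-! ## Proved glue and the composition (no `sorry` below this line) -/

/-- Pure counting: if every `P`-particle has a `Q`-particle `C`-related to it, and the particles with
some `C`-related `Q`-particle number at most `M · #Q`, then `#P ≤ M · #Q`. -/
theorem card_le_mul_card_of_cover {N : ℕ} (P Q : Fin N → Prop) (C : Fin N → Fin N → Prop) (M : ℕ)
    (hcount : Nat.card {i : Fin N // ∃ j : Fin N, Q j ∧ C j i} ≤ M * Nat.card {j : Fin N // Q j})
    (hcover : ∀ i, P i → ∃ j, Q j ∧ C j i) :
    Nat.card {i : Fin N // P i} ≤ M * Nat.card {j : Fin N // Q j} := by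
  refine le_trans ?_ hcount
  refine Nat.card_le_card_of_injective (fun i => ⟨i.1, hcover i.1 i.2⟩) ?_
  intro i j hij
  apply Subtype.ext
  simpa using congrArg Subtype.val hij

/-- **The crux from the three stubs, concluded BY NAME** (type literally the route decl
`HcpDefectCounting.HcpChartGluing`; no hypotheses — the stubs are discharged inside the proof and
`sorry` lives only in `stub_*`).  `(θ, D)` from local propagation (`stub_compactnessUpgrade` fed with
`stub_exactLocalRigidity`), `M` from `stub_neighbourhoodCount δ D`; every `Bad(R,ε)` particle has a
`Bad(4,θ)` particle within `D`, so `#Bad(R,ε) ≤ M · #Bad(4,θ)` by `card_le_mul_card_of_cover`. -/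
theorem HcpChartGluing_of :
    Summit.AtomisticToContinuum.Crystallization.Theses.HcpDefectCounting.HcpChartGluing := by
  intro a h ha hh h₁ h₂ h₃ h₄ δ R ε hδ hR hε
  obtain ⟨θ, hθ, D, hD⟩ :=
    stub_compactnessUpgrade a h h₁ h₂ h₃ h₄ (stub_exactLocalRigidity a h h₁ h₂ h₃ h₄) δ R ε hδ hR hε
  obtain ⟨M, hM⟩ := stub_neighbourhoodCount δ D hδ
  refine ⟨θ, hθ, M, fun N x hsep => ?_⟩
  dsimp only
  rw [hcpPeriodicConfiguration_points]
  refine card_le_mul_card_of_cover _ _ _ M (hM N x hsep _) fun i hi => ?_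
  by_contra hcon
  apply hi
  apply hD N x hsep i
  intro j hj
  by_contra hbad
  exact hcon ⟨j, hbad, hj⟩

end Summit.AtomisticToContinuum.Crystallization.Cruxes.HcpChartGluing.Birth

end
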